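import Mathlib.Analysis.Calculus.FDeriv.Symmetric
import Mathlib.Analysis.Calculus.ContDiff.Bounds
import Mathlib.Analysis.Calculus.MeanValue
import Mathlib.Analysis.Normed.Module.Multilinear.Curry
import HarnessLib

/-!
# Quantitative Laplace method — W3-lite: SYMMETRY OF THE THIRD DERIVATIVE of a `C³` function, polarisation, and Hessian-form Lipschitz ∕ coercivity
# transfer from DIRECTIONAL CUBES `|D³F(p)[w,w,w]| ≤ A₃‖w‖³` (no operator norm of `D³F` needed)
# (free-hands support of ⟨stmt-QuantumFields-24197⟩ `SwapVirialDeficit.SwapGluedStiffness`; cell ym-idea-1, LEAD g98 (S-core)(b): the Hessian transfer `0 → η⋆`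
# «Hessian at the follower minimiser ≥ λ_F∕2» needs exactly this, the tree's jets being DIRECTIONAL (✓`taylor_four_gnoDeficit_line`, ✓`fibre_third_bound`))

✓`hessian_lower_on_closedBall_of_third` ∕ ✓`abs_hessianForm_sub_le_of_third` (file ✓`…QuantitativeLaplaceHessianLipschitz`) take the OPERATOR norm
`‖iteratedFDeriv ℝ 3 F z‖ ≤ M₃`; the model only has cubes `|D³F(z)[w,w,w]| ≤ A₃‖w‖³`, and Mathlib's symmetry of `iteratedFDeriv ℝ n` for `n ≥ 3` is stated for
`C^ω` only (`ContDiffAt.iteratedFDeriv_comp_perm`).  Here, for `F : V → ℝ` of class `C³` on a real normed space: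
* §1 `iteratedFDeriv_three_apply` (`D³F(p)[a,b,c] = ∂_a∂_b∂_c F`), ★ `iteratedFDeriv_three_swap01` (Schwarz for `DF`), ★ `iteratedFDeriv_three_swap12` (Schwarz for `F`,
  pushed through `fderiv` by the slot-swap isometry `domDomCongrₗᵢ`) — the full `S₃`-symmetry of `D³F(p)`; `iteratedFDeriv_three_add_left` ∕ `_smul_left` (slot linearity);
* §2 `polar_zvv` — for an abstract slot-symmetric, slot-linear `t`: `6·t(z,v,v) = t(v+z)³ − t(v−z)³ − 2·t(z)³`, and ★ `abs_zvv_le_of_cubes`: `|t(z,v,v)| ≤ 3A‖z‖‖v‖²`;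
* §3 ★★ `abs_iteratedFDeriv_three_zvv_le_of_cubes` — `|D³F(p)[z,v,v]| ≤ 3A₃‖z‖‖v‖²` from `|D³F(p)[w,w,w]| ≤ A₃‖w‖³`;
* §4 ★★ `abs_hessianForm_sub_le_of_cubes` — `|D²F(x)[v,v] − D²F(x′)[v,v]| ≤ 3A₃‖x − x′‖‖v‖²` on a convex set carrying the cubes; ★★ `hessian_lower_on_closedBall_of_cubes` —
  COERCIVITY TRANSFER `λ‖v‖² ≤ D²F(x₀)[v,v] ⟹ (λ − 3A₃r)‖v‖² ≤ D²F(x)[v,v]` on `B̄(x₀, r)` (the `hH` of ✓`strongConvex_of_hessian_lower`, the `hlam` of ✓`form_floor_of_third_directional`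
  AT THE MINIMISER).

HONEST FRAMING: generic calculus; no model object; ⟨24197⟩, ⟨24194⟩, own crux ⟨22884⟩ (blocked-on ⟨19935⟩) OPEN; the Yang–Mills mass gap is NOT proved; no summit is proved by a
line.  THEOREMS ONLY (0 `def`, 0 `sorry`), standard axioms.  Width seat ym-line-sfw-p2-w2 g59 (cell ym-idea-1, free hands), `--supports stmt-QuantumFields-24197`.
References: [folklore] (Schwarz, polarisation, mean-value inequality); [cite: HasenpflugRudolfSprungk2024, §3.1] (assumptions of the fibred Laplace method).
-/

set_option autoImplicit false

noncomputable section

open Set Metric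
open scoped ContDiff

namespace Summit.QuantumFields.YangMills.Theorems.QuantitativeLaplace

section ThirdSymm

variable {V : Type*} [NormedAddCommGroup V] [NormedSpace ℝ V]

/-! ## §1 Symmetry and slot linearity of `D³F(p)` -/

/-- `D³F(p)[m₀,m₁,m₂] = ∂_{m₀}∂_{m₁}∂_{m₂}F(p)` (nested Fréchet derivatives). [folklore] -/
theorem iteratedFDeriv_three_apply (F : V → ℝ) (p : V) (m : Fin 3 → V) :
    iteratedFDeriv ℝ 3 F p m = fderiv ℝ (fderiv ℝ (fderiv ℝ F)) p (m 0) (m 1) (m 2) := by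
  rw [iteratedFDeriv_succ_apply_right, iteratedFDeriv_two_apply]
  rfl

/-- ★ Schwarz for `DF`: `D³F(p)[a,b,c] = D³F(p)[b,a,c]` (`F ∈ C³`). [folklore] -/
theorem iteratedFDeriv_three_swap01 {F : V → ℝ} (hF : ContDiff ℝ 3 F) (p a b c : V) :
    iteratedFDeriv ℝ 3 F p ![a, b, c] = iteratedFDeriv ℝ 3 F p ![b, a, c] := by
  have hg : ContDiff ℝ 2 (fderiv ℝ F) := hF.fderiv_right (by norm_num)
  have hsymm : IsSymmSndFDerivAt ℝ (fderiv ℝ F) p :=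
    (hg.contDiffAt).isSymmSndFDerivAt (by simp [minSmoothness_of_isRCLikeNormedField])
  rw [iteratedFDeriv_three_apply, iteratedFDeriv_three_apply]
  simp only [Matrix.cons_val_zero, Matrix.cons_val_one, Matrix.cons_val_two, Matrix.head_cons, Matrix.tail_cons]
  rw [hsymm a b]

/-- ★ Schwarz for `F`, one derivative up: `D³F(p)[a,b,c] = D³F(p)[a,c,b]` (`F ∈ C³`; the slot swap is a linear isometry commuting with `fderiv`). [folklore] -/
theorem iteratedFDeriv_three_swap12 {F : V → ℝ} (hF : ContDiff ℝ 3 F) (p a b c : V) :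
    iteratedFDeriv ℝ 3 F p ![a, b, c] = iteratedFDeriv ℝ 3 F p ![a, c, b] := by
  have h2 : ∀ q : V, (iteratedFDeriv ℝ 2 F q).domDomCongr Fin.revPerm = iteratedFDeriv ℝ 2 F q := fun q =>
    isSymmSndFDerivAt_iff_iteratedFDeriv.1 ((hF.contDiffAt (x := q)).isSymmSndFDerivAt
      (by simp [minSmoothness_of_isRCLikeNormedField]; norm_num))
  set L := ContinuousMultilinearMap.domDomCongrₗᵢ ℝ V ℝ (Fin.revPerm : Equiv.Perm (Fin 2)) with hL
  have hLapp : ∀ f : ContinuousMultilinearMap ℝ (fun _ : Fin 2 => V) ℝ, L f = f.domDomCongr Fin.revPerm := fun f => rfl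
  have hfun : iteratedFDeriv ℝ 2 F = fun q => L (iteratedFDeriv ℝ 2 F q) := by
    funext q; rw [hLapp]; exact (h2 q).symm
  have hd : fderiv ℝ (iteratedFDeriv ℝ 2 F) p = (L : _ →L[ℝ] _).comp (fderiv ℝ (iteratedFDeriv ℝ 2 F) p) := by
    conv_lhs => rw [hfun]
    exact L.toContinuousLinearEquiv.comp_fderiv
  rw [iteratedFDeriv_succ_apply_left, iteratedFDeriv_succ_apply_left]
  simp only [Matrix.cons_val_zero]
  conv_lhs => rw [hd]
  rw [ContinuousLinearMap.coe_comp, Function.comp_apply]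
  show (L (fderiv ℝ (iteratedFDeriv ℝ 2 F) p a)) ![b, c] = (fderiv ℝ (iteratedFDeriv ℝ 2 F) p a) ![c, b]
  rw [hLapp, ContinuousMultilinearMap.domDomCongr_apply]
  congr 1
  funext i
  fin_cases i <;> rfl

omit [NormedAddCommGroup V] [NormedSpace ℝ V] in
/-- `Fin.tail ![x,b,c] = ![b,c]`. [folklore] -/
theorem tail_vec3 (x b c : V) : Fin.tail ![x, b, c] = ![b, c] := by
  funext i
  fin_cases i <;> rfl

/-- Additivity in the first slot. [folklore] -/
theorem iteratedFDeriv_three_add_left (F : V → ℝ) (p a a' b c : V) :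
    iteratedFDeriv ℝ 3 F p ![a + a', b, c] = iteratedFDeriv ℝ 3 F p ![a, b, c] + iteratedFDeriv ℝ 3 F p ![a', b, c] := by
  rw [iteratedFDeriv_succ_apply_left, iteratedFDeriv_succ_apply_left, iteratedFDeriv_succ_apply_left]
  simp only [Matrix.cons_val_zero, tail_vec3, map_add]
  rfl

/-- Homogeneity in the first slot. [folklore] -/
theorem iteratedFDeriv_three_smul_left (F : V → ℝ) (p : V) (r : ℝ) (a b c : V) :
    iteratedFDeriv ℝ 3 F p ![r • a, b, c] = r * iteratedFDeriv ℝ 3 F p ![a, b, c] := by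
  rw [iteratedFDeriv_succ_apply_left, iteratedFDeriv_succ_apply_left]
  simp only [Matrix.cons_val_zero, tail_vec3, map_smul]
  rfl

/-- The cube in `![w,w,w]` form is the cube in `fun _ => w` form. [folklore] -/
theorem iteratedFDeriv_three_cube_eq (F : V → ℝ) (p w : V) : iteratedFDeriv ℝ 3 F p ![w, w, w] = iteratedFDeriv ℝ 3 F p (fun _ => w) := by
  congr 1
  funext i
  fin_cases i <;> rfl

/-! ## §2 Polarisation for an abstract slot-symmetric, slot-linear `t` -/

/-- `6·t(z,v,v) = t(v+z,v+z,v+z) − t(v−z,v−z,v−z) − 2·t(z,z,z)` for `t` additive and homogeneous in the first slot and symmetric under the two slot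
transpositions. [folklore] -/
theorem polar_zvv {t : V → V → V → ℝ} (hadd : ∀ a a' b c, t (a + a') b c = t a b c + t a' b c) (hsmul : ∀ (r : ℝ) a b c, t (r • a) b c = r * t a b c)
    (h01 : ∀ a b c, t a b c = t b a c) (h12 : ∀ a b c, t a b c = t a c b) (z v : V) :
    6 * t z v v = t (v + z) (v + z) (v + z) - t (v - z) (v - z) (v - z) - 2 * t z z z := by
  -- additivity ∕ negation in every slot
  have hadd1 : ∀ a b b' c, t a (b + b') c = t a b c + t a b' c := fun a b b' c => by rw [h01, hadd, h01, h01 b' a c]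
  have hadd2 : ∀ a b c c', t a b (c + c') = t a b c + t a b c' := fun a b c c' => by rw [h12, hadd1, h12, h12 a c' b]
  have hneg0 : ∀ a b c, t (-a) b c = -t a b c := fun a b c => by rw [← neg_one_smul ℝ a, hsmul]; ring
  have hneg1 : ∀ a b c, t a (-b) c = -t a b c := fun a b c => by rw [h01, hneg0, h01]
  have hneg2 : ∀ a b c, t a b (-c) = -t a b c := fun a b c => by rw [h12, hneg1, h12]
  -- the two orbits of mixed terms
  have e1 : t v v z = t z v v := by rw [h12, h01]
  have e2 : t v z v = t z v v := by rw [h01]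
  have e3 : t z z v = t v z z := by rw [h12, h01]
  have e4 : t z v z = t v z z := by rw [h01]
  simp only [sub_eq_add_neg, hadd, hadd1, hadd2, hneg0, hneg1, hneg2]
  rw [e1, e2, e3, e4]
  ring

/-- ★ **The mixed bound from cubes**: if moreover `|t(w,w,w)| ≤ A‖w‖³` for all `w`, then `|t(z,v,v)| ≤ 3A‖z‖‖v‖²` (`A ≥ 0`). [folklore] -/
theorem abs_zvv_le_of_cubes {t : V → V → V → ℝ} (hadd : ∀ a a' b c, t (a + a') b c = t a b c + t a' b c) (hsmul : ∀ (r : ℝ) a b c, t (r • a) b c = r * t a b c)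
    (h01 : ∀ a b c, t a b c = t b a c) (h12 : ∀ a b c, t a b c = t a c b) {A : ℝ} (hA : 0 ≤ A) (hcube : ∀ w, |t w w w| ≤ A * ‖w‖ ^ 3) (z v : V) :
    |t z v v| ≤ 3 * A * ‖z‖ * ‖v‖ ^ 2 := by
  -- homogeneity in all slots
  have hsmul1 : ∀ (r : ℝ) a b c, t a (r • b) c = r * t a b c := fun r a b c => by rw [h01, hsmul, h01]
  have hsmul2 : ∀ (r : ℝ) a b c, t a b (r • c) = r * t a b c := fun r a b c => by rw [h12, hsmul1, h12]
  by_cases hz : z = 0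
  · rw [hz, ← zero_smul ℝ (0 : V), hsmul]; simp
  by_cases hv : v = 0
  · rw [hv, ← zero_smul ℝ (0 : V), hsmul1]; simp
  have hz0 : 0 < ‖z‖ := norm_pos_iff.2 hz
  have hv0 : 0 < ‖v‖ := norm_pos_iff.2 hv
  -- unit vectors
  set z1 : V := ‖z‖⁻¹ • z with hz1
  set v1 : V := ‖v‖⁻¹ • v with hv1
  have hz1n : ‖z1‖ = 1 := by rw [hz1, norm_smul, norm_inv, norm_norm, inv_mul_cancel₀ hz0.ne']
  have hv1n : ‖v1‖ = 1 := by rw [hv1, norm_smul, norm_inv, norm_norm, inv_mul_cancel₀ hv0.ne']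
  have hzz : z = ‖z‖ • z1 := by rw [hz1, smul_smul, mul_inv_cancel₀ hz0.ne', one_smul]
  have hvv : v = ‖v‖ • v1 := by rw [hv1, smul_smul, mul_inv_cancel₀ hv0.ne', one_smul]
  have hscale : t z v v = ‖z‖ * ‖v‖ ^ 2 * t z1 v1 v1 := by
    conv_lhs => rw [hzz, hvv]
    rw [hsmul, hsmul1, hsmul2]; ring
  -- the unit estimate
  have hp := polar_zvv hadd hsmul h01 h12 z1 v1
  have b1 := hcube (v1 + z1)
  have b2 := hcube (v1 - z1)
  have b3 := hcube z1
  have n1 : ‖v1 + z1‖ ≤ 2 := by calc ‖v1 + z1‖ ≤ ‖v1‖ + ‖z1‖ := norm_add_le _ _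
    _ = 2 := by rw [hv1n, hz1n]; norm_num
  have n2 : ‖v1 - z1‖ ≤ 2 := by calc ‖v1 - z1‖ ≤ ‖v1‖ + ‖z1‖ := norm_sub_le _ _
    _ = 2 := by rw [hv1n, hz1n]; norm_num
  have c1 : A * ‖v1 + z1‖ ^ 3 ≤ A * 8 := by
    refine mul_le_mul_of_nonneg_left ?_ hA
    calc ‖v1 + z1‖ ^ 3 ≤ 2 ^ 3 := pow_le_pow_left₀ (norm_nonneg _) n1 3
      _ = 8 := by norm_num
  have c2 : A * ‖v1 - z1‖ ^ 3 ≤ A * 8 := by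
    refine mul_le_mul_of_nonneg_left ?_ hA
    calc ‖v1 - z1‖ ^ 3 ≤ 2 ^ 3 := pow_le_pow_left₀ (norm_nonneg _) n2 3
      _ = 8 := by norm_num
  rw [hz1n, one_pow, mul_one] at b3
  have hunit : |t z1 v1 v1| ≤ 3 * A := by
    rw [abs_le] at b1 b2 b3 ⊢
    constructor <;> linarith [b1.1, b1.2, b2.1, b2.2, b3.1, b3.2]
  rw [hscale, abs_mul, abs_of_nonneg (by positivity : (0 : ℝ) ≤ ‖z‖ * ‖v‖ ^ 2)]
  calc ‖z‖ * ‖v‖ ^ 2 * |t z1 v1 v1| ≤ ‖z‖ * ‖v‖ ^ 2 * (3 * A) := by gcongr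
    _ = 3 * A * ‖z‖ * ‖v‖ ^ 2 := by ring

/-! ## §3 The mixed third derivative from cubes -/

/-- ★★ **`|D³F(p)[z,v,v]| ≤ 3A₃‖z‖‖v‖²` from `|D³F(p)[w,w,w]| ≤ A₃‖w‖³`** (`F ∈ C³`). [folklore] -/
theorem abs_iteratedFDeriv_three_zvv_le_of_cubes {F : V → ℝ} (hF : ContDiff ℝ 3 F) (p : V) {A₃ : ℝ} (hA : 0 ≤ A₃)
    (hcube : ∀ w : V, |iteratedFDeriv ℝ 3 F p (fun _ => w)| ≤ A₃ * ‖w‖ ^ 3) (z v : V) :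
    |iteratedFDeriv ℝ 3 F p ![z, v, v]| ≤ 3 * A₃ * ‖z‖ * ‖v‖ ^ 2 :=
  abs_zvv_le_of_cubes (t := fun a b c => iteratedFDeriv ℝ 3 F p ![a, b, c]) (iteratedFDeriv_three_add_left F p) (iteratedFDeriv_three_smul_left F p)
    (iteratedFDeriv_three_swap01 hF p) (iteratedFDeriv_three_swap12 hF p) hA (fun w => by rw [iteratedFDeriv_three_cube_eq]; exact hcube w) z v

/-! ## §4 Hessian-form Lipschitz and coercivity transfer from cubes -/

/-- The Hessian form `q ↦ D²F(q)[v,v]` has derivative `w ↦ D³F(q)[w,v,v]`. [folklore] -/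
theorem hasFDerivAt_hessianForm {F : V → ℝ} (hF : ContDiff ℝ 3 F) (v q : V) :
    HasFDerivAt (fun q => iteratedFDeriv ℝ 2 F q (fun _ => v))
      ((ContinuousMultilinearMap.apply ℝ (fun _ : Fin 2 => V) ℝ (fun _ => v)).comp (fderiv ℝ (iteratedFDeriv ℝ 2 F) q)) q := by
  have hlt : ((2 : ℕ) : WithTop ℕ∞) < 3 := by exact_mod_cast (show (2 : ℕ) < 3 by norm_num)
  have hd : DifferentiableAt ℝ (iteratedFDeriv ℝ 2 F) q := hF.differentiable_iteratedFDeriv hlt q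
  exact (ContinuousMultilinearMap.apply ℝ (fun _ : Fin 2 => V) ℝ (fun _ => v)).hasFDerivAt.comp q hd.hasFDerivAt

/-- The derivative of the Hessian form, evaluated: `D(q ↦ D²F(q)[v,v])(q)[w] = D³F(q)[w,v,v]`. [folklore] -/
theorem fderiv_hessianForm_apply {F : V → ℝ} (hF : ContDiff ℝ 3 F) (v q w : V) :
    fderiv ℝ (fun q => iteratedFDeriv ℝ 2 F q (fun _ => v)) q w = iteratedFDeriv ℝ 3 F q ![w, v, v] := by
  rw [(hasFDerivAt_hessianForm hF v q).fderiv, ContinuousLinearMap.coe_comp, Function.comp_apply, ContinuousMultilinearMap.apply_apply,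
    iteratedFDeriv_succ_apply_left]
  simp only [Matrix.cons_val_zero]
  congr 1
  funext i
  fin_cases i <;> rfl

/-- ★★ **Lipschitz HESSIAN FORM from cubes**: `|D²F(x)[v,v] − D²F(x′)[v,v]| ≤ 3A₃‖x − x′‖‖v‖²` for `x, x′` in a convex set carrying
`|D³F(z)[w,w,w]| ≤ A₃‖w‖³`. [folklore] -/
theorem abs_hessianForm_sub_le_of_cubes {F : V → ℝ} (hF : ContDiff ℝ 3 F) {s : Set V} (hs : Convex ℝ s) {A₃ : ℝ} (hA : 0 ≤ A₃)
    (hcube : ∀ z ∈ s, ∀ w : V, |iteratedFDeriv ℝ 3 F z (fun _ => w)| ≤ A₃ * ‖w‖ ^ 3) {x x' : V} (hx : x ∈ s) (hx' : x' ∈ s) (v : V) :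
    |iteratedFDeriv ℝ 2 F x (fun _ => v) - iteratedFDeriv ℝ 2 F x' (fun _ => v)| ≤ 3 * A₃ * ‖x - x'‖ * ‖v‖ ^ 2 := by
  have hbd : ∀ z ∈ s, ‖fderiv ℝ (fun q => iteratedFDeriv ℝ 2 F q (fun _ => v)) z‖ ≤ 3 * A₃ * ‖v‖ ^ 2 := by
    intro z hz
    refine ContinuousLinearMap.opNorm_le_bound _ (by positivity) fun w => ?_
    rw [fderiv_hessianForm_apply hF, Real.norm_eq_abs]
    calc |iteratedFDeriv ℝ 3 F z ![w, v, v]| ≤ 3 * A₃ * ‖w‖ * ‖v‖ ^ 2 := abs_iteratedFDeriv_three_zvv_le_of_cubes hF z hA (hcube z hz) w v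
      _ = 3 * A₃ * ‖v‖ ^ 2 * ‖w‖ := by ring
  have h := hs.norm_image_sub_le_of_norm_fderiv_le (f := fun q => iteratedFDeriv ℝ 2 F q (fun _ => v))
    (fun z _ => (hasFDerivAt_hessianForm hF v z).differentiableAt) hbd hx' hx
  rw [Real.norm_eq_abs] at h
  calc _ ≤ 3 * A₃ * ‖v‖ ^ 2 * ‖x - x'‖ := h
    _ = 3 * A₃ * ‖x - x'‖ * ‖v‖ ^ 2 := by ring

/-- ★★ **COERCIVITY TRANSFER from cubes**: a Hessian floor `λ‖v‖² ≤ D²F(x₀)[v,v]` at ONE point and cubes `|D³F(z)[w,w,w]| ≤ A₃‖w‖³` on `B̄(x₀, r)` give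
`(λ − 3A₃r)‖v‖² ≤ D²F(x)[v,v]` for every `x ∈ B̄(x₀, r)` — the `hH` of ✓`strongConvex_of_hessian_lower`, the Hessian floor AT THE MINIMISER for
✓`form_floor_of_third_directional`. [folklore] -/
theorem hessian_lower_on_closedBall_of_cubes {F : V → ℝ} (hF : ContDiff ℝ 3 F) {x₀ : V} {r A₃ : ℝ} (hA : 0 ≤ A₃)
    (hcube : ∀ z ∈ closedBall x₀ r, ∀ w : V, |iteratedFDeriv ℝ 3 F z (fun _ => w)| ≤ A₃ * ‖w‖ ^ 3) {lam : ℝ}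
    (hlam : ∀ v : V, lam * ‖v‖ ^ 2 ≤ iteratedFDeriv ℝ 2 F x₀ (fun _ => v)) :
    ∀ x ∈ closedBall x₀ r, ∀ v : V, (lam - 3 * A₃ * r) * ‖v‖ ^ 2 ≤ iteratedFDeriv ℝ 2 F x (fun _ => v) := by
  intro x hx v
  have hr : 0 ≤ r := le_trans dist_nonneg (mem_closedBall.1 hx)
  have h := abs_hessianForm_sub_le_of_cubes hF (convex_closedBall x₀ r) hA hcube hx (mem_closedBall_self hr) v
  have hxr : ‖x - x₀‖ ≤ r := by rwa [mem_closedBall, dist_eq_norm] at hx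
  have h1 := hlam v
  have h2 := (abs_le.1 h).1
  have h3 : 3 * A₃ * ‖x - x₀‖ * ‖v‖ ^ 2 ≤ 3 * A₃ * r * ‖v‖ ^ 2 := by gcongr
  nlinarith

/-- ★ **The upper twin**: `D²F(x₀)[v,v] ≤ Λ‖v‖²` and cubes on `B̄(x₀,r)` give `D²F(x)[v,v] ≤ (Λ + 3A₃r)‖v‖²` there. [folklore] -/
theorem hessian_upper_on_closedBall_of_cubes {F : V → ℝ} (hF : ContDiff ℝ 3 F) {x₀ : V} {r A₃ : ℝ} (hA : 0 ≤ A₃)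
    (hcube : ∀ z ∈ closedBall x₀ r, ∀ w : V, |iteratedFDeriv ℝ 3 F z (fun _ => w)| ≤ A₃ * ‖w‖ ^ 3) {Lam : ℝ}
    (hLam : ∀ v : V, iteratedFDeriv ℝ 2 F x₀ (fun _ => v) ≤ Lam * ‖v‖ ^ 2) :
    ∀ x ∈ closedBall x₀ r, ∀ v : V, iteratedFDeriv ℝ 2 F x (fun _ => v) ≤ (Lam + 3 * A₃ * r) * ‖v‖ ^ 2 := by
  intro x hx v
  have hr : 0 ≤ r := le_trans dist_nonneg (mem_closedBall.1 hx)
  have h := abs_hessianForm_sub_le_of_cubes hF (convex_closedBall x₀ r) hA hcube hx (mem_closedBall_self hr) v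
  have hxr : ‖x - x₀‖ ≤ r := by rwa [mem_closedBall, dist_eq_norm] at hx
  have h1 := hLam v
  have h2 := (abs_le.1 h).2
  have h3 : 3 * A₃ * ‖x - x₀‖ * ‖v‖ ^ 2 ≤ 3 * A₃ * r * ‖v‖ ^ 2 := by gcongr
  nlinarith

end ThirdSymm

end Summit.QuantumFields.YangMills.Theorems.QuantitativeLaplace

end
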